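import Summits.AtomisticToContinuum.Crystallization.Theorems.FrustratedLawDichotomyStrainedPatchHomCurvRegime

/-!
# Closed-form curvature coefficients `α, α′, α″, β` of `W₄₅` on the bump and Lennard-Jones regimes, with their derivative chain (centred leaf, real side)

decomp-a2c hand-1 g27 (crux `AperiodicFrustratedLawGap`, stmt-AtomisticToContinuum-27623; `(H) HomFloor (1/625)`, hcp half; lever (C)).  The centred
curvature leaf applies `…HomHessPath.pathForm_secondOrder` with `A = α = (W″ − W′/ρ)/ρ²`, `B = β = W′/ρ` (the coefficient functions of
`…HomConvexCurvature.segGd_eq_rankOne`) on a tube inside the bump regime `(0, 8/5)` or the Lennard-Jones regime `(8/5, 3)`.  There `α, β` are the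
explicit functions below (`…HomCurvRegime.alpha_lj / alpha_bump / beta_lj / beta_bump`, rewritten: the bump correction of `α` is the POLYNOMIAL
`(75/2048)·T(5ρ/4)`, `T(w) = S′(w)/w`), so their first and second derivatives are closed forms obtained by symbolic differentiation — no `W‴`, `W⁗`:

* §1 Lennard-Jones: `α = 14ρ⁻¹⁶ − 8ρ⁻¹⁰`, `α′ = −224ρ⁻¹⁷ + 80ρ⁻¹¹`, `α″ = 3808ρ⁻¹⁸ − 880ρ⁻¹²`, `β = ρ⁻⁸ − ρ⁻¹⁴`;
* §2 bump: `α_B = α − (75/2048)T(w)`, `α_B′ = α′ − (75/2048)(5/4)T′(w)`, `α_B″ = α″ − (75/2048)(25/16)T″(w)`, `β_B = β − (3/128)S(w)`, `w = 5ρ/4`;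
* everywhere `β′ = αρ` and `(αρ)′ = α′ρ + α`;
* §3 regime links: on the open regimes the true coefficient functions `ρ ↦ (W₄₅″(ρ) − W₄₅′(ρ)/ρ)/ρ²`, `ρ ↦ W₄₅′(ρ)/ρ` EQUAL these closed forms, hence
  inherit the derivative chain (`hasDerivAt_alphaTrue_lj/bump`, `hasDerivAt_betaTrue_lj/bump`) — the `hA, hA₁, hB, hB₁` inputs of `pathForm_secondOrder`.

Real closed-form definitions (docstring'd) + calculus; 0 sorry; standard axioms; no instances / notation / `#eval`.  `--supports stmt-AtomisticToContinuum-27623`.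
-/

noncomputable section

namespace Summit.AtomisticToContinuum.Crystallization.Theorems.FrustratedLawDichotomyStrainedPatchHomCurvRegime3

open Filter Topology
open Summit.AtomisticToContinuum.Crystallization.Theorems.FrustratedLawDichotomySchurCut (effPot w₄₅ ω₄)
open Summit.AtomisticToContinuum.Crystallization.Theorems.FrustratedLawDichotomyStrainedPatchHomCurvRegime
  (alpha_lj beta_lj alpha_bump beta_bump)

/-! ## §1. Lennard-Jones regime: closed forms and derivative chain -/

/-- `α = 14ρ⁻¹⁶ − 8ρ⁻¹⁰` (LJ regime). -/
def alphaLJ (ρ : ℝ) : ℝ := 14 * (ρ⁻¹) ^ 16 - 8 * (ρ⁻¹) ^ 10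

/-- `α′ = −224ρ⁻¹⁷ + 80ρ⁻¹¹` (LJ regime). -/
def alpha1LJ (ρ : ℝ) : ℝ := -224 * (ρ⁻¹) ^ 17 + 80 * (ρ⁻¹) ^ 11

/-- `α″ = 3808ρ⁻¹⁸ − 880ρ⁻¹²` (LJ regime). -/
def alpha2LJ (ρ : ℝ) : ℝ := 3808 * (ρ⁻¹) ^ 18 - 880 * (ρ⁻¹) ^ 12

/-- `β = ρ⁻⁸ − ρ⁻¹⁴` (LJ regime). -/
def betaLJ (ρ : ℝ) : ℝ := (ρ⁻¹) ^ 8 - (ρ⁻¹) ^ 14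

/-- `α′ = α₁` (LJ closed forms). [folklore] -/
theorem hasDerivAt_alphaLJ {r : ℝ} (hr : r ≠ 0) : HasDerivAt alphaLJ (alpha1LJ r) r := by
  have h1 : HasDerivAt (fun s : ℝ => s⁻¹) (-(r ^ 2)⁻¹) r := hasDerivAt_inv hr
  have h := ((h1.fun_pow 16).const_mul (14 : ℝ)).fun_sub ((h1.fun_pow 10).const_mul (8 : ℝ))
  have hfun : alphaLJ = fun s : ℝ => 14 * (s⁻¹) ^ 16 - 8 * (s⁻¹) ^ 10 := by funext s; rfl
  rw [hfun]
  refine h.congr_deriv ?_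
  have e17 : (r⁻¹) ^ 17 = (r⁻¹) ^ 15 * (r ^ 2)⁻¹ := by rw [← inv_pow]; ring
  have e11 : (r⁻¹) ^ 11 = (r⁻¹) ^ 9 * (r ^ 2)⁻¹ := by rw [← inv_pow]; ring
  rw [alpha1LJ, e17, e11]
  push_cast
  ring

/-- `α₁′ = α₂` (LJ closed forms). [folklore] -/
theorem hasDerivAt_alpha1LJ {r : ℝ} (hr : r ≠ 0) : HasDerivAt alpha1LJ (alpha2LJ r) r := by
  have h1 : HasDerivAt (fun s : ℝ => s⁻¹) (-(r ^ 2)⁻¹) r := hasDerivAt_inv hr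
  have h := ((h1.fun_pow 17).const_mul (-224 : ℝ)).fun_add ((h1.fun_pow 11).const_mul (80 : ℝ))
  have hfun : alpha1LJ = fun s : ℝ => -224 * (s⁻¹) ^ 17 + 80 * (s⁻¹) ^ 11 := by funext s; rfl
  rw [hfun]
  refine h.congr_deriv ?_
  have e18 : (r⁻¹) ^ 18 = (r⁻¹) ^ 16 * (r ^ 2)⁻¹ := by rw [← inv_pow]; ring
  have e12 : (r⁻¹) ^ 12 = (r⁻¹) ^ 10 * (r ^ 2)⁻¹ := by rw [← inv_pow]; ring
  rw [alpha2LJ, e18, e12]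
  push_cast
  ring

/-- `β′ = αρ` (LJ closed forms). [folklore] -/
theorem hasDerivAt_betaLJ {r : ℝ} (hr : r ≠ 0) : HasDerivAt betaLJ (alphaLJ r * r) r := by
  have h1 : HasDerivAt (fun s : ℝ => s⁻¹) (-(r ^ 2)⁻¹) r := hasDerivAt_inv hr
  have h := (h1.fun_pow 8).fun_sub (h1.fun_pow 14)
  have hfun : betaLJ = fun s : ℝ => (s⁻¹) ^ 8 - (s⁻¹) ^ 14 := by funext s; rfl
  rw [hfun]
  refine h.congr_deriv ?_
  have e : alphaLJ r * r = 14 * ((r⁻¹) ^ 13 * (r ^ 2)⁻¹) - 8 * ((r⁻¹) ^ 7 * (r ^ 2)⁻¹) := by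
    have p16 : (r⁻¹) ^ 16 * r = (r⁻¹) ^ 15 := by rw [pow_succ, mul_assoc, inv_mul_cancel₀ hr, mul_one]
    have p10 : (r⁻¹) ^ 10 * r = (r⁻¹) ^ 9 := by rw [pow_succ, mul_assoc, inv_mul_cancel₀ hr, mul_one]
    have hsq : (r ^ 2)⁻¹ = (r⁻¹) ^ 2 := (inv_pow r 2).symm
    calc alphaLJ r * r = 14 * ((r⁻¹) ^ 16 * r) - 8 * ((r⁻¹) ^ 10 * r) := by rw [alphaLJ]; ring
      _ = 14 * ((r⁻¹) ^ 13 * (r ^ 2)⁻¹) - 8 * ((r⁻¹) ^ 7 * (r ^ 2)⁻¹) := by rw [p16, p10, hsq]; ring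
  rw [e]
  push_cast
  ring

/-- `(αρ)′ = α′ρ + α` (LJ closed forms). [folklore] -/
theorem hasDerivAt_alphaLJ_mul {r : ℝ} (hr : r ≠ 0) : HasDerivAt (fun s => alphaLJ s * s) (alpha1LJ r * r + alphaLJ r) r := by
  have h := (hasDerivAt_alphaLJ hr).mul (hasDerivAt_id' r)
  exact h.congr_deriv (by ring)

/-! ## §2. Bump regime: the profile polynomials and the closed forms -/

/-- `T(w) = S′(w)/w = 33/2 − 1155/64 w + 1155/256 w³ − 693/1024 w⁵ + 495/12288 w⁷` (so that `α_bump = α_LJ − (75/2048)·T(5ρ/4)`). -/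
def bumpT (w : ℝ) : ℝ := 33 / 2 - 1155 / 64 * w + 1155 / 256 * w ^ 3 - 693 / 1024 * w ^ 5 + 495 / 12288 * w ^ 7

/-- `T′(w)`. -/
def bumpT1 (w : ℝ) : ℝ := -(1155 / 64) + 3465 / 256 * w ^ 2 - 3465 / 1024 * w ^ 4 + 3465 / 12288 * w ^ 6

/-- `T″(w)`. -/
def bumpT2 (w : ℝ) : ℝ := 3465 / 128 * w - 3465 / 256 * w ^ 3 + 3465 / 2048 * w ^ 5

/-- `S(w) = ω′(w)/w = −11/3 + 33/4 w² − 385/64 w³ + 231/256 w⁵ − 99/1024 w⁷ + 55/12288 w⁹` (so that `β_bump = β_LJ − (3/128)·S(5ρ/4)`). -/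
def bumpS (w : ℝ) : ℝ := -(11 / 3) + 33 / 4 * w ^ 2 - 385 / 64 * w ^ 3 + 231 / 256 * w ^ 5 - 99 / 1024 * w ^ 7 + 55 / 12288 * w ^ 9

/-- `α` on the bump regime. -/
def alphaB (ρ : ℝ) : ℝ := alphaLJ ρ - 75 / 2048 * bumpT (5 * ρ / 4)

/-- `α′` on the bump regime. -/
def alpha1B (ρ : ℝ) : ℝ := alpha1LJ ρ - 75 / 2048 * (5 / 4 * bumpT1 (5 * ρ / 4))

/-- `α″` on the bump regime. -/
def alpha2B (ρ : ℝ) : ℝ := alpha2LJ ρ - 75 / 2048 * (25 / 16 * bumpT2 (5 * ρ / 4))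

/-- `β` on the bump regime. -/
def betaB (ρ : ℝ) : ℝ := betaLJ ρ - 3 / 128 * bumpS (5 * ρ / 4)

/-- `T′ = T₁`. [folklore] -/
theorem hasDerivAt_bumpT (w : ℝ) : HasDerivAt bumpT (bumpT1 w) w := by
  have hid := hasDerivAt_id' w
  have h := ((((hid.const_mul (1155 / 64 : ℝ)).const_sub (33 / 2 : ℝ)).fun_add ((hid.fun_pow 3).const_mul (1155 / 256 : ℝ))).fun_sub
    ((hid.fun_pow 5).const_mul (693 / 1024 : ℝ))).fun_add ((hid.fun_pow 7).const_mul (495 / 12288 : ℝ))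
  have hfun : bumpT = fun s : ℝ => 33 / 2 - 1155 / 64 * s + 1155 / 256 * s ^ 3 - 693 / 1024 * s ^ 5 + 495 / 12288 * s ^ 7 := by funext s; rfl
  rw [hfun]
  refine h.congr_deriv ?_
  rw [bumpT1]
  push_cast
  ring

/-- `T₁′ = T₂`. [folklore] -/
theorem hasDerivAt_bumpT1 (w : ℝ) : HasDerivAt bumpT1 (bumpT2 w) w := by
  have hid := hasDerivAt_id' w
  have h := ((((hid.fun_pow 2).const_mul (3465 / 256 : ℝ)).const_add (-(1155 / 64) : ℝ)).fun_sub ((hid.fun_pow 4).const_mul (3465 / 1024 : ℝ))).fun_add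
    ((hid.fun_pow 6).const_mul (3465 / 12288 : ℝ))
  have hfun : bumpT1 = fun s : ℝ => -(1155 / 64) + 3465 / 256 * s ^ 2 - 3465 / 1024 * s ^ 4 + 3465 / 12288 * s ^ 6 := by funext s; rfl
  rw [hfun]
  refine h.congr_deriv ?_
  rw [bumpT2]
  push_cast
  ring

/-- `S′(w) = w·T(w)`. [folklore] -/
theorem hasDerivAt_bumpS (w : ℝ) : HasDerivAt bumpS (w * bumpT w) w := by
  have hid := hasDerivAt_id' w
  have h := ((((((hid.fun_pow 2).const_mul (33 / 4 : ℝ)).const_add (-(11 / 3) : ℝ)).fun_sub ((hid.fun_pow 3).const_mul (385 / 64 : ℝ))).fun_add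
    ((hid.fun_pow 5).const_mul (231 / 256 : ℝ))).fun_sub ((hid.fun_pow 7).const_mul (99 / 1024 : ℝ))).fun_add
    ((hid.fun_pow 9).const_mul (55 / 12288 : ℝ))
  have hfun : bumpS = fun s : ℝ => -(11 / 3) + 33 / 4 * s ^ 2 - 385 / 64 * s ^ 3 + 231 / 256 * s ^ 5 - 99 / 1024 * s ^ 7 + 55 / 12288 * s ^ 9 := by
    funext s; rfl
  rw [hfun]
  refine h.congr_deriv ?_
  rw [bumpT]
  push_cast
  ring

/-- `w = 5ρ/4` has derivative `5/4`. [folklore] -/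
theorem hasDerivAt_wOf (r : ℝ) : HasDerivAt (fun s : ℝ => 5 * s / 4) (5 / 4 : ℝ) r := by
  simpa using ((hasDerivAt_id r).const_mul (5 : ℝ)).div_const 4

/-- `α_B′ = α_B₁`. [folklore] -/
theorem hasDerivAt_alphaB {r : ℝ} (hr : r ≠ 0) : HasDerivAt alphaB (alpha1B r) r := by
  have hT0 := hasDerivAt_bumpT (5 * r / 4)
  have hT := hT0.comp r (hasDerivAt_wOf r)
  have h := (hasDerivAt_alphaLJ hr).sub (hT.const_mul (75 / 2048 : ℝ))
  have hfun : alphaB = fun s => alphaLJ s - 75 / 2048 * bumpT (5 * s / 4) := by funext s; rfl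
  rw [hfun]
  exact h.congr_deriv (by rw [alpha1B]; ring)

/-- `α_B₁′ = α_B₂`. [folklore] -/
theorem hasDerivAt_alpha1B {r : ℝ} (hr : r ≠ 0) : HasDerivAt alpha1B (alpha2B r) r := by
  have hT0 := hasDerivAt_bumpT1 (5 * r / 4)
  have hT := hT0.comp r (hasDerivAt_wOf r)
  have h := (hasDerivAt_alpha1LJ hr).sub ((hT.const_mul (5 / 4 : ℝ)).const_mul (75 / 2048 : ℝ))
  have hfun : alpha1B = fun s => alpha1LJ s - 75 / 2048 * (5 / 4 * bumpT1 (5 * s / 4)) := by funext s; rfl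
  rw [hfun]
  exact h.congr_deriv (by rw [alpha2B]; ring)

/-- `β_B′ = α_Bρ`. [folklore] -/
theorem hasDerivAt_betaB {r : ℝ} (hr : r ≠ 0) : HasDerivAt betaB (alphaB r * r) r := by
  have hS0 := hasDerivAt_bumpS (5 * r / 4)
  have hS := hS0.comp r (hasDerivAt_wOf r)
  have h := (hasDerivAt_betaLJ hr).sub (hS.const_mul (3 / 128 : ℝ))
  have hfun : betaB = fun s => betaLJ s - 3 / 128 * bumpS (5 * s / 4) := by funext s; rfl
  rw [hfun]
  exact h.congr_deriv (by rw [alphaB]; ring)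

/-- `(α_Bρ)′ = α_B′ρ + α_B`. [folklore] -/
theorem hasDerivAt_alphaB_mul {r : ℝ} (hr : r ≠ 0) : HasDerivAt (fun s => alphaB s * s) (alpha1B r * r + alphaB r) r := by
  have h := (hasDerivAt_alphaB hr).mul (hasDerivAt_id' r)
  exact h.congr_deriv (by ring)

/-! ## §3. Regime links: the true coefficient functions equal the closed forms on the open regimes -/

/-- ★ On the LJ regime the true `α` is `alphaLJ`. [arithmetic: `…HomCurvRegime.alpha_lj`] -/
theorem alphaTrue_eq_lj {r : ℝ} (h1 : 8 / 5 < r) (h2 : r < 3) :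
    (deriv (deriv (effPot w₄₅ ω₄ (3 / 400))) r - deriv (effPot w₄₅ ω₄ (3 / 400)) r / r) / r ^ 2 = alphaLJ r := by
  rw [alpha_lj h1 h2, alphaLJ, ← inv_pow, ← pow_mul, ← pow_mul]

/-- ★ On the LJ regime the true `β` is `betaLJ`. [arithmetic: `…HomCurvRegime.beta_lj`] -/
theorem betaTrue_eq_lj {r : ℝ} (h1 : 8 / 5 < r) (h2 : r < 3) : deriv (effPot w₄₅ ω₄ (3 / 400)) r / r = betaLJ r := by
  rw [beta_lj h1 h2, betaLJ, ← inv_pow, ← pow_mul, ← pow_mul]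

/-- ★ On the bump regime the true `α` is `alphaB` (the `(P₂ − S)/ρ²` correction is the polynomial `(25/16)·T(w)`). [arithmetic: `…HomCurvRegime.alpha_bump`] -/
theorem alphaTrue_eq_bump {r : ℝ} (h0 : 0 < r) (h1 : r < 8 / 5) :
    (deriv (deriv (effPot w₄₅ ω₄ (3 / 400))) r - deriv (effPot w₄₅ ω₄ (3 / 400)) r / r) / r ^ 2 = alphaB r := by
  have hr : r ≠ 0 := h0.ne'
  rw [alpha_bump h0 h1, alphaB, alphaLJ, bumpT]
  field_simp
  ring

/-- ★ On the bump regime the true `β` is `betaB`. [arithmetic: `…HomCurvRegime.beta_bump`] -/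
theorem betaTrue_eq_bump {r : ℝ} (h0 : 0 < r) (h1 : r < 8 / 5) : deriv (effPot w₄₅ ω₄ (3 / 400)) r / r = betaB r := by
  have hr : r ≠ 0 := h0.ne'
  rw [beta_bump h0 h1, betaB, betaLJ, bumpS]
  field_simp
  ring

/-- ★ `HasDerivAt` of the true `α` on the LJ regime (`= α₁`). [folklore: local equality with the closed form] -/
theorem hasDerivAt_alphaTrue_lj {r : ℝ} (h1 : 8 / 5 < r) (h2 : r < 3) :
    HasDerivAt (fun s => (deriv (deriv (effPot w₄₅ ω₄ (3 / 400))) s - deriv (effPot w₄₅ ω₄ (3 / 400)) s / s) / s ^ 2) (alpha1LJ r) r := by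
  have heq : (fun s => (deriv (deriv (effPot w₄₅ ω₄ (3 / 400))) s - deriv (effPot w₄₅ ω₄ (3 / 400)) s / s) / s ^ 2) =ᶠ[𝓝 r] alphaLJ := by
    filter_upwards [Ioo_mem_nhds h1 h2] with s hs using alphaTrue_eq_lj hs.1 hs.2
  exact (hasDerivAt_alphaLJ (by linarith : r ≠ 0)).congr_of_eventuallyEq heq

/-- ★ `HasDerivAt` of the true `β` on the LJ regime (`= αρ`). [folklore] -/
theorem hasDerivAt_betaTrue_lj {r : ℝ} (h1 : 8 / 5 < r) (h2 : r < 3) :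
    HasDerivAt (fun s => deriv (effPot w₄₅ ω₄ (3 / 400)) s / s) (alphaLJ r * r) r := by
  have heq : (fun s => deriv (effPot w₄₅ ω₄ (3 / 400)) s / s) =ᶠ[𝓝 r] betaLJ := by
    filter_upwards [Ioo_mem_nhds h1 h2] with s hs using betaTrue_eq_lj hs.1 hs.2
  exact (hasDerivAt_betaLJ (by linarith : r ≠ 0)).congr_of_eventuallyEq heq

/-- ★ `HasDerivAt` of the true `α` on the bump regime (`= α_B₁`). [folklore] -/
theorem hasDerivAt_alphaTrue_bump {r : ℝ} (h0 : 0 < r) (h1 : r < 8 / 5) :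
    HasDerivAt (fun s => (deriv (deriv (effPot w₄₅ ω₄ (3 / 400))) s - deriv (effPot w₄₅ ω₄ (3 / 400)) s / s) / s ^ 2) (alpha1B r) r := by
  have heq : (fun s => (deriv (deriv (effPot w₄₅ ω₄ (3 / 400))) s - deriv (effPot w₄₅ ω₄ (3 / 400)) s / s) / s ^ 2) =ᶠ[𝓝 r] alphaB := by
    filter_upwards [Ioo_mem_nhds h0 h1] with s hs using alphaTrue_eq_bump hs.1 hs.2
  exact (hasDerivAt_alphaB h0.ne').congr_of_eventuallyEq heq

/-- ★ `HasDerivAt` of the true `β` on the bump regime (`= α_Bρ`). [folklore] -/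
theorem hasDerivAt_betaTrue_bump {r : ℝ} (h0 : 0 < r) (h1 : r < 8 / 5) :
    HasDerivAt (fun s => deriv (effPot w₄₅ ω₄ (3 / 400)) s / s) (alphaB r * r) r := by
  have heq : (fun s => deriv (effPot w₄₅ ω₄ (3 / 400)) s / s) =ᶠ[𝓝 r] betaB := by
    filter_upwards [Ioo_mem_nhds h0 h1] with s hs using betaTrue_eq_bump hs.1 hs.2
  exact (hasDerivAt_betaB h0.ne').congr_of_eventuallyEq heq

end Summit.AtomisticToContinuum.Crystallization.Theorems.FrustratedLawDichotomyStrainedPatchHomCurvRegime3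

end
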